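import Summits.CriticalPhenomena.PercolationContinuityZ3.Theorems.PercNearOneGluingNoHeavyLowerTailSahiTwoLevelWForm
import Summits.CriticalPhenomena.PercolationContinuityZ3.Theorems.PercNearOneGluingNoHeavyLowerTailSahiTwoLevelIdleFace
import Summits.CriticalPhenomena.PercolationContinuityZ3.Theorems.PercNearOneGluingNoHeavyLowerTailSahiTwoLevelIndependentTops
import Summits.CriticalPhenomena.PercolationContinuityZ3.Theorems.PercNearOneGluingNoHeavyLowerTailSahiTwoLevelBernsteinBridge
import Summits.CriticalPhenomena.PercolationContinuityZ3.Theorems.PercNearOneGluingNoHeavyLowerTailSahiCoSunflowerTwoLevel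
import Mathlib.Tactic.Linarith
import Mathlib.Tactic.Ring
import HarnessLib

/-!
# The VARIATIONAL ROUTE to the two-level TOP law: the compact form of `T⁺`, its separate affinity in the six events (four monotone
# moves), the solved faces collected, and the reduction  "descent to a solved face ⟹ Kahn's `C_3`"  by induction on a determining set

Support file of the one-cut programme (crux `NoHeavyLowerTail`, stmt-CriticalPhenomena-4575; master-family line P2 = Sahi's algebraic route,
seat `prim-masterthm-p2` gen 20; memo `run/shared/lean/prim/prim-masterthm/FROM-prim-masterthm-p2-g20-VARIATIONAL-ROUTE.md`).
ONE `@[conjecture]` definition (`SolvedFaceDescent`, an obligation of THIS programme — census-clean, NOT a published fact); no sorry.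

SETTING (`…SahiTwoLevelC3`, `…SahiTwoLevelKappa/IdleFace/CostlessSlots/WForm/IndependentTops` of lane prim-bnk-2).  For a nested pair `H_i ⊆ G_i`
(`i = 0,1,2`) of triples of increasing events of a finite cube under `μ = prodBernoulli q`, the TOP two-level form is
`T⁺(G,H) = twoLevelForm μ G H − ∏_i (μ G_i − μ H_i)` (`topForm`; `= 3β₂ − β₃` of the fibre cubic whose sections are `(G,H)`).
`SahiTwoLevelPlus` (`T⁺ ≥ 0` at every nested pair) implies Kahn's Conjecture 5 (`kahnConjecture_of_sahiTwoLevelPlus`).  THIS FILE: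

* `topForm_eq_compact` — **`T⁺ = 2μ(H₀H₁H₂) − Σ_i μ(G_i)μ(H_jH_k) − Σ_i μ(H_i)·Cov(G_j,G_k) + 2μ(G₀G₁G₂) − μ(G₀)μ(G₁)μ(G₂)`**
  (ring identity).  Hence `T⁺` is AFFINE in each of the six events SEPARATELY, with NO `H_i × G_i` cross term, and the point
  coefficients have fixed signs off/on the intersection of the two partner events; the resulting four MONOTONE MOVES are in the companion
  file `…SahiTwoLevelVariationalMoves` (`topForm_bottom_union_le/…sdiff_le`, `topForm_top_union_le/…sdiff_le`).
* `FaceAt` / `InSolvedFace` — the faces on which `T⁺ ≥ 0` is ALREADY PROVED from `E_3 ≥ 0` for triples drawn from the six events (+ Harris):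
  the W-face `H₀ ∩ G₁ ∩ G₂ ⊆ H₁ ∩ H₂` (bnk-2 `…WForm`; contains two idle slots, an empty bottom, two costless slots), the costless-inside face
  (`…CostlessSlots`), independent tops (`…IndependentTops`), `κ₃(G) ≥ 0` (`…Kappa`), and one idle slot with nonnegative bracket
  (`…IdleFace`, `twoLevelTop_eq_of_idle₀`); `topForm_nonneg_of_inSolvedFace` packages them (three slot rotations, `topForm_rot`).
* **`SolvedFaceDescent`** (`@[conjecture]`, the typed TARGET of the route): every nested pair of increasing triples determined by a coordinate
  set `S` admits a nested pair of increasing triples determined by `S`, IN A SOLVED FACE, with no larger `T⁺`.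
  CENSUS (this seat, exact integer arithmetic, code `code/c/{nash4,stab3}.c` of the memo): steepest / random-improvement descent under
  single-event and same-slot-pair replacements reaches a solved face from EVERY start tried — `{0,1}^3`: all 4 741 632 nested sextuples at 7 bias
  vectors are covered, and ALL 90 224 STABLE sextuples (no strictly improving replacement) lie in a solved face; `{0,1}^4`: 3.9·10⁵ descents at
  random biases, 0 exceptions; `{0,1}^5`: kit census (job j178107).  A global minimiser of `T⁺` is stable, so "stable ⟹ solved face" would prove it.
* **`sahiE3_nonneg_of_solvedFaceDescentOn`** — THE REDUCTION (induction on the size of a determining set, local step = P1's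
  `sahiE_three_nonneg_of_weakTwoLevelAt`): on a fixed cube and weight, solved-face descent for every coordinate set gives `E_3 ≥ 0` for every
  triple of increasing events; hence `kahnConjecture_of_solvedFaceDescent`, `masterFamilyNonneg_three_of_solvedFaceDescent`.
  The point: unlike every finite-depth TYPE-LEVEL certificate (impossible: P2 gen 19–20 pseudo-laws), this route uses extremality.

HONEST LABEL: identities, monotone moves, a packaging of proved faces, a typed obligation and its reduction; nothing here asserts
`SolvedFaceDescent`, `SahiTwoLevelPlus` or Kahn's Conjecture 5 (all OPEN).  Axioms standard. [this work]
-/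

noncomputable section

open scoped Classical

namespace Summit.CriticalPhenomena.PercolationContinuityZ3.Theorems

namespace SahiTwoLevelVariational

open Finset Function MeasureTheory
open Literature.Combinatorics.Sahi2008
open Literature.Probability.LatticeModels (prodBernoulli prodBernoulli_harris sahiE3 sahiE3_def)
open Literature.Probability.Percolation (DeterminedBy determinedBy_iff)
open Literature.Probability.Percolation.DecisionTree (ind ind_of_mem ind_of_not_mem ind_nonneg)
open SahiCoordinateBernstein (coordPiece₂)

variable {κ : Type} [Fintype κ]

/-! ### 1. The TOP two-level form and its compact expression -/

/-- **The TOP two-level form** `T⁺(G,H) = twoLevelForm μ G H − ∏_i (μ G_i − μ H_i)` (`= 3β₂ − β₃` at the sections of a fibre). [this work] -/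
def topForm (q : κ → unitInterval) (G H : Fin 3 → Set (Set κ)) : ℝ :=
  twoLevelForm (fun A => (prodBernoulli q).real A) G H
    - ∏ i, ((prodBernoulli q).real (G i) - (prodBernoulli q).real (H i))

omit [Fintype κ] in
/-- Unfolding lemma for `topForm`. [this work] -/
theorem topForm_def (q : κ → unitInterval) (G H : Fin 3 → Set (Set κ)) :
    topForm q G H = twoLevelForm (fun A => (prodBernoulli q).real A) G H
      - ∏ i, ((prodBernoulli q).real (G i) - (prodBernoulli q).real (H i)) := rfl

omit [Fintype κ] in
/-- **COMPACT FORM**: `T⁺ = 2μ(H₀H₁H₂) − Σ_i μ(G_i)μ(H_jH_k) − Σ_i μ(H_i)(μ(G_jG_k) − μ(G_j)μ(G_k)) + 2μ(G₀G₁G₂) − μ(G₀)μ(G₁)μ(G₂)`.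
No term couples `H_i` with `G_i`: `T⁺` is affine in each of the six events separately. [this work] -/
theorem topForm_eq_compact (q : κ → unitInterval) (G H : Fin 3 → Set (Set κ)) :
    topForm q G H =
      2 * (prodBernoulli q).real (H 0 ∩ H 1 ∩ H 2)
      - ((prodBernoulli q).real (G 0) * (prodBernoulli q).real (H 1 ∩ H 2)
          + (prodBernoulli q).real (G 1) * (prodBernoulli q).real (H 0 ∩ H 2)
          + (prodBernoulli q).real (G 2) * (prodBernoulli q).real (H 0 ∩ H 1))
      - ((prodBernoulli q).real (H 0) * ((prodBernoulli q).real (G 1 ∩ G 2) - (prodBernoulli q).real (G 1) * (prodBernoulli q).real (G 2))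
          + (prodBernoulli q).real (H 1) * ((prodBernoulli q).real (G 0 ∩ G 2) - (prodBernoulli q).real (G 0) * (prodBernoulli q).real (G 2))
          + (prodBernoulli q).real (H 2) * ((prodBernoulli q).real (G 0 ∩ G 1) - (prodBernoulli q).real (G 0) * (prodBernoulli q).real (G 1)))
      + 2 * (prodBernoulli q).real (G 0 ∩ G 1 ∩ G 2)
      - (prodBernoulli q).real (G 0) * (prodBernoulli q).real (G 1) * (prodBernoulli q).real (G 2) := by
  simp only [topForm, twoLevelForm, Fin.prod_univ_three]
  ring

/-! ### 2. Slot rotation -/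

/-- Cyclic rotation of a triple of events: `(X₁, X₂, X₀)`. [this work] -/
def rot (X : Fin 3 → Set (Set κ)) : Fin 3 → Set (Set κ) := ![X 1, X 2, X 0]

omit [Fintype κ] in
/-- Slot `0` of the rotation. [this work] -/
@[simp] theorem rot_zero (X : Fin 3 → Set (Set κ)) : rot X 0 = X 1 := rfl
omit [Fintype κ] in
/-- Slot `1` of the rotation. [this work] -/
@[simp] theorem rot_one (X : Fin 3 → Set (Set κ)) : rot X 1 = X 2 := rfl
omit [Fintype κ] in
/-- Slot `2` of the rotation. [this work] -/
@[simp] theorem rot_two (X : Fin 3 → Set (Set κ)) : rot X 2 = X 0 := rfl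

omit [Fintype κ] in
/-- `T⁺` is invariant under the simultaneous cyclic rotation of the slots. [this work] -/
theorem topForm_rot (q : κ → unitInterval) (G H : Fin 3 → Set (Set κ)) :
    topForm q (rot G) (rot H) = topForm q G H := by
  rw [topForm_eq_compact, topForm_eq_compact]
  simp only [rot_zero, rot_one, rot_two]
  have e1 : H 1 ∩ H 2 ∩ H 0 = H 0 ∩ H 1 ∩ H 2 := by ext ω; simp only [Set.mem_inter_iff]; tauto
  have e2 : G 1 ∩ G 2 ∩ G 0 = G 0 ∩ G 1 ∩ G 2 := by ext ω; simp only [Set.mem_inter_iff]; tauto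
  rw [e1, e2, Set.inter_comm (H 2) (H 0), Set.inter_comm (H 1) (H 0), Set.inter_comm (G 2) (G 0), Set.inter_comm (G 1) (G 0)]
  ring


/-! ### 3. The solved faces (slot `0` designated) and the packaging over slot rotations -/

/-- **The solved faces with slot `0` designated.**  Each disjunct is a face of the nested-pair space on which `T⁺ ≥ 0` is PROVED from
`E_3 ≥ 0` for triples drawn from the six events (lane prim-bnk-2): the W-face `H₀ ∩ G₁ ∩ G₂ ⊆ H₁ ∩ H₂` (contains: slots `1,2` idle;
`H₀ = ∅`; slots `1,2` costless), the costless-inside face (slot `0` costless and `D₁ ∩ D₂ ⊆ G₀`), independent tops (`G₀`, `G₁` determined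
by complementary coordinate sets), `κ₃(G) ≥ 0`, and slot `0` idle with nonnegative bracket
`μ(G₀)δ₁δ₂ ≤ δ₂·μ(G₀ ∩ D₁) + δ₁·μ(G₀ ∩ D₂)`. [this work] -/
def FaceAt (q : κ → unitInterval) (G H : Fin 3 → Set (Set κ)) : Prop :=
  (H 0 ∩ G 1 ∩ G 2 ⊆ H 1 ∩ H 2)
  ∨ (G 0 ∩ G 1 ∩ G 2 ⊆ H 0 ∧ (G 1 \ H 1) ∩ (G 2 \ H 2) ⊆ G 0)
  ∨ (∃ T : Finset κ, DeterminedBy (G 0) (↑T : Set κ)ᶜ ∧ DeterminedBy (G 1) (↑T : Set κ))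
  ∨ (0 ≤ thirdCentralMoment (fun A => (prodBernoulli q).real A) G)
  ∨ (H 0 = G 0 ∧
      (prodBernoulli q).real (G 0) * ((prodBernoulli q).real (G 1) - (prodBernoulli q).real (H 1))
          * ((prodBernoulli q).real (G 2) - (prodBernoulli q).real (H 2)) ≤
        ((prodBernoulli q).real (G 2) - (prodBernoulli q).real (H 2))
            * ((prodBernoulli q).real (G 0 ∩ G 1) - (prodBernoulli q).real (G 0 ∩ H 1))
        + ((prodBernoulli q).real (G 1) - (prodBernoulli q).real (H 1))
            * ((prodBernoulli q).real (G 0 ∩ G 2) - (prodBernoulli q).real (G 0 ∩ H 2)))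

/-- **In a solved face**: `FaceAt` for one of the three cyclic rotations of the slots. [this work] -/
def InSolvedFace (q : κ → unitInterval) (G H : Fin 3 → Set (Set κ)) : Prop :=
  FaceAt q G H ∨ FaceAt q (rot G) (rot H) ∨ FaceAt q (rot (rot G)) (rot (rot H))

/-- The hypothesis "`E_3 ≥ 0` for every triple drawn from the six events `G_j, H_j`". [this work] -/
def MixedE3Nonneg (q : κ → unitInterval) (G H : Fin 3 → Set (Set κ)) : Prop :=
  ∀ X : Fin 3 → Set (Set κ), (∀ i, ∃ j, X i = G j ∨ X i = H j) → 0 ≤ sahiE3 (prodBernoulli q) (X 0) (X 1) (X 2)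

omit [Fintype κ] in
/-- `MixedE3Nonneg` is stable under rotating the slots. [this work] -/
theorem mixedE3Nonneg_rot (q : κ → unitInterval) {G H : Fin 3 → Set (Set κ)} (hE : MixedE3Nonneg q G H) :
    MixedE3Nonneg q (rot G) (rot H) := by
  intro X hX
  refine hE X fun i => ?_
  obtain ⟨j, hj⟩ := hX i
  fin_cases j
  · exact ⟨1, hj⟩
  · exact ⟨2, hj⟩
  · exact ⟨0, hj⟩

/-- **`T⁺ ≥ 0` on `FaceAt`** from `E_3 ≥ 0` for the mixed triples (and Harris). [this work] -/
theorem topForm_nonneg_of_faceAt (q : κ → unitInterval) (G H : Fin 3 → Set (Set κ))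
    (hG : ∀ i, IsUpperSet (G i)) (hH : ∀ i, IsUpperSet (H i)) (hHG : ∀ i, H i ⊆ G i)
    (hE : MixedE3Nonneg q G H) (hF : FaceAt q G H) : 0 ≤ topForm q G H := by
  have eG : 0 ≤ sahiE3 (prodBernoulli q) (G 0) (G 1) (G 2) :=
    hE G fun i => ⟨i, Or.inl rfl⟩
  have eHGG : 0 ≤ sahiE3 (prodBernoulli q) (H 0) (G 1) (G 2) := by
    have := hE ![H 0, G 1, G 2] fun i => by fin_cases i <;> [exact ⟨0, Or.inr rfl⟩; exact ⟨1, Or.inl rfl⟩; exact ⟨2, Or.inl rfl⟩]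
    simpa using this
  have eGHG : 0 ≤ sahiE3 (prodBernoulli q) (G 0) (H 1) (G 2) := by
    have := hE ![G 0, H 1, G 2] fun i => by fin_cases i <;> [exact ⟨0, Or.inl rfl⟩; exact ⟨1, Or.inr rfl⟩; exact ⟨2, Or.inl rfl⟩]
    simpa using this
  have eGGH : 0 ≤ sahiE3 (prodBernoulli q) (G 0) (G 1) (H 2) := by
    have := hE ![G 0, G 1, H 2] fun i => by fin_cases i <;> [exact ⟨0, Or.inl rfl⟩; exact ⟨1, Or.inl rfl⟩; exact ⟨2, Or.inr rfl⟩]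
    simpa using this
  have eGHH : 0 ≤ sahiE3 (prodBernoulli q) (G 0) (H 1) (H 2) := by
    have := hE ![G 0, H 1, H 2] fun i => by fin_cases i <;> [exact ⟨0, Or.inl rfl⟩; exact ⟨1, Or.inr rfl⟩; exact ⟨2, Or.inr rfl⟩]
    simpa using this
  rw [topForm_def]
  rcases hF with hW | ⟨hc0, hin⟩ | ⟨T, hT0, hT1⟩ | hκ | ⟨h0, hbr⟩
  · exact SahiTwoLevelWForm.twoLevelTop_nonneg_of_wFace₀ q G H hG (hHG 1) (hHG 2) hW eG eHGG
  · exact SahiTwoLevelIdle.twoLevelTop_nonneg_of_costless₀_inside q G H hG (hHG 0) (hHG 1) (hHG 2) hc0 hin eGHG eGGH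
  · exact SahiTwoLevelIndep.twoLevelPlus_nonneg_of_determinedBy q T G H hG hH hHG hT0 hT1
  · exact twoLevelPlus_nonneg_of_thirdCentralMoment_nonneg q G H hG hH hHG hκ
  · rw [SahiTwoLevelIdle.twoLevelTop_eq_of_idle₀ q G H h0]
    linarith

/-- **`T⁺ ≥ 0` IN A SOLVED FACE** from `E_3 ≥ 0` for the mixed triples (and Harris). [this work] -/
theorem topForm_nonneg_of_inSolvedFace (q : κ → unitInterval) (G H : Fin 3 → Set (Set κ))
    (hG : ∀ i, IsUpperSet (G i)) (hH : ∀ i, IsUpperSet (H i)) (hHG : ∀ i, H i ⊆ G i)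
    (hE : MixedE3Nonneg q G H) (hF : InSolvedFace q G H) : 0 ≤ topForm q G H := by
  have hGr : ∀ X : Fin 3 → Set (Set κ), (∀ i, IsUpperSet (X i)) → ∀ i, IsUpperSet (rot X i) := by
    intro X hX i; fin_cases i <;> simp [rot] <;> exact hX _
  have hHGr : ∀ X Y : Fin 3 → Set (Set κ), (∀ i, Y i ⊆ X i) → ∀ i, rot Y i ⊆ rot X i := by
    intro X Y hXY i; fin_cases i <;> simp [rot] <;> exact hXY _
  rcases hF with h | h | h
  · exact topForm_nonneg_of_faceAt q G H hG hH hHG hE h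
  · rw [← topForm_rot]
    exact topForm_nonneg_of_faceAt q _ _ (hGr G hG) (hGr H hH) (hHGr G H hHG) (mixedE3Nonneg_rot q hE) h
  · rw [← topForm_rot, ← topForm_rot]
    exact topForm_nonneg_of_faceAt q _ _ (hGr _ (hGr G hG)) (hGr _ (hGr H hH)) (hHGr _ _ (hHGr G H hHG))
      (mixedE3Nonneg_rot q (mixedE3Nonneg_rot q hE)) h


/-! ### 4. The typed target: descent to a solved face -/

/-- **Solved-face descent on a fixed cube and weight**: every nested pair of increasing triples determined by a coordinate set `S` admits a
nested pair of increasing triples determined by `S`, lying in a solved face, with no larger `T⁺`. [this work] -/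
def SolvedFaceDescentOn (q : κ → unitInterval) : Prop :=
  ∀ (S : Finset κ) (G H : Fin 3 → Set (Set κ)), (∀ i, IsUpperSet (G i)) → (∀ i, IsUpperSet (H i)) → (∀ i, H i ⊆ G i) →
    (∀ i, DeterminedBy (G i) (↑S : Set κ)) → (∀ i, DeterminedBy (H i) (↑S : Set κ)) →
    ∃ G' H' : Fin 3 → Set (Set κ), (∀ i, IsUpperSet (G' i)) ∧ (∀ i, IsUpperSet (H' i)) ∧ (∀ i, H' i ⊆ G' i) ∧
      (∀ i, DeterminedBy (G' i) (↑S : Set κ)) ∧ (∀ i, DeterminedBy (H' i) (↑S : Set κ)) ∧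
      InSolvedFace q G' H' ∧ topForm q G' H' ≤ topForm q G H

/-- **CONJECTURE (solved-face descent; the typed target of the VARIATIONAL ROUTE)**, an obligation of THIS programme (NOT a published fact):
solved-face descent holds on every finite cube for every product weight.  A global minimiser of `T⁺` over the (finite) set of nested pairs of
increasing triples determined by `S` is stable under single-event and same-slot-pair replacements, so the conjecture follows from
"every STABLE nested pair lies in a solved face" — census-clean: `{0,1}^3` exhaustively (all 90 224 stable sextuples among 4 741 632, 7 bias
vectors), `{0,1}^4` (3.9·10⁵ descents, random biases) and `{0,1}^5` (kit j178107), exact integer arithmetic; seat prim-masterthm-p2 gen 20.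
Implies Kahn's Conjecture 5 (`kahnConjecture_of_solvedFaceDescent`). [cite: Kahn2022, Conj. 5 (arXiv p. 3)] [status: open] -/
@[conjecture] def SolvedFaceDescent : Prop :=
  ∀ (κ : Type) [Fintype κ] (q : κ → unitInterval), SolvedFaceDescentOn q

/-! ### 5. The reduction: solved-face descent ⟹ `E_3 ≥ 0` (induction on a determining set) -/

/-- Events determined by no coordinate give `E_3 = 0`. [this work] -/
theorem sahiE3_eq_zero_of_determinedBy_empty (q : κ → unitInterval) {X Y Z : Set (Set κ)}
    (hX : DeterminedBy X ((∅ : Finset κ) : Set κ)) (hY : DeterminedBy Y ((∅ : Finset κ) : Set κ))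
    (hZ : DeterminedBy Z ((∅ : Finset κ) : Set κ)) : sahiE3 (prodBernoulli q) X Y Z = 0 := by
  have hV : ∀ j, DeterminedBy ((![X, Y, Z] : Fin 3 → Set (Set κ)) j) ((∅ : Finset κ) : Set κ) := by
    intro j; fin_cases j
    · exact hX
    · exact hY
    · exact hZ
  have h0 := masterFamilyEqIff_mpr 3 κ q ![X, Y, Z] (Pointwise.suppZeroFlag_three_of_determinedBy_empty _ hV)
  rw [Pointwise.ind_vec3, sahiE_three_ind] at h0
  exact h0

/-- **THE REDUCTION on a fixed cube and weight**: solved-face descent for every coordinate set gives `E_3(μ_q; A, B, C) ≥ 0` for all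
increasing events.  Induction on the size of a determining set `S`: the sections along `e ∈ S` of a triple determined by `S` form a nested
pair determined by `S ∖ {e}`; descent moves it into a solved face without raising `T⁺`; there `T⁺ ≥ 0` by the induction hypothesis
(`E_3 ≥ 0` for the mixed triples) and Harris; so `T⁺ ≥ 0` at the sections (`3β₂ ≥ β₃`), and the weak local step
(`SahiCoSunflowerTwoLevel.sahiE_three_nonneg_of_weakTwoLevelAt`) closes. [this work] -/
theorem sahiE3_nonneg_of_solvedFaceDescentOn (q : κ → unitInterval) (hD : SolvedFaceDescentOn q)
    {A B C : Set (Set κ)} (hA : IsUpperSet A) (hB : IsUpperSet B) (hC : IsUpperSet C) :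
    0 ≤ sahiE3 (prodBernoulli q) A B C := by
  suffices key : ∀ (m : ℕ) (X Y Z : Set (Set κ)) (S : Finset κ), S.card = m → IsUpperSet X → IsUpperSet Y → IsUpperSet Z →
      DeterminedBy X (↑S : Set κ) → DeterminedBy Y (↑S : Set κ) → DeterminedBy Z (↑S : Set κ) →
      0 ≤ sahiE3 (prodBernoulli q) X Y Z from
    key _ A B C Finset.univ rfl hA hB hC
      ((determinedBy_iff _ _).2 fun ω ω' hω => by
        rw [Finset.coe_univ, Set.inter_univ, Set.inter_univ] at hω; rw [hω])
      ((determinedBy_iff _ _).2 fun ω ω' hω => by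
        rw [Finset.coe_univ, Set.inter_univ, Set.inter_univ] at hω; rw [hω])
      ((determinedBy_iff _ _).2 fun ω ω' hω => by
        rw [Finset.coe_univ, Set.inter_univ, Set.inter_univ] at hω; rw [hω])
  intro m
  induction m using Nat.strong_induction_on with
  | _ m ih =>
  intro X Y Z S hS hX hY hZ hXS hYS hZS
  rcases S.eq_empty_or_nonempty with hSe | hSne
  · subst hSe
    exact (sahiE3_eq_zero_of_determinedBy_empty q hXS hYS hZS).ge
  · obtain ⟨e, heS⟩ := hSne
    have hlt : (S.erase e).card < m := by rw [← hS]; exact Finset.card_erase_lt_of_mem heS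
    -- induction hypothesis on `S.erase e`, as a statement about all increasing triples determined by it
    have IH : ∀ X' Y' Z' : Set (Set κ), IsUpperSet X' → IsUpperSet Y' → IsUpperSet Z' →
        DeterminedBy X' (↑(S.erase e) : Set κ) → DeterminedBy Y' (↑(S.erase e) : Set κ) → DeterminedBy Z' (↑(S.erase e) : Set κ) →
        0 ≤ sahiE3 (prodBernoulli q) X' Y' Z' :=
      fun X' Y' Z' h1 h2 h3 d1 d2 d3 => ih _ hlt X' Y' Z' (S.erase e) rfl h1 h2 h3 d1 d2 d3
    -- the sections along `e`
    set G : Fin 3 → Set (Set κ) := ![secAt e true X, secAt e true Y, secAt e true Z] with hGdef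
    set H : Fin 3 → Set (Set κ) := ![secAt e false X, secAt e false Y, secAt e false Z] with hHdef
    have hGup : ∀ i, IsUpperSet (G i) := by
      intro i; fin_cases i
      · exact isUpperSet_secAt e true hX
      · exact isUpperSet_secAt e true hY
      · exact isUpperSet_secAt e true hZ
    have hHup : ∀ i, IsUpperSet (H i) := by
      intro i; fin_cases i
      · exact isUpperSet_secAt e false hX
      · exact isUpperSet_secAt e false hY
      · exact isUpperSet_secAt e false hZ
    have hHG : ∀ i, H i ⊆ G i := by
      intro i; fin_cases i
      · exact SahiTwoLevel.secAt_false_subset_true e hX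
      · exact SahiTwoLevel.secAt_false_subset_true e hY
      · exact SahiTwoLevel.secAt_false_subset_true e hZ
    have hGdet : ∀ i, DeterminedBy (G i) (↑(S.erase e) : Set κ) := by
      intro i; fin_cases i
      · exact determinedBy_secAt e true hXS
      · exact determinedBy_secAt e true hYS
      · exact determinedBy_secAt e true hZS
    have hHdet : ∀ i, DeterminedBy (H i) (↑(S.erase e) : Set κ) := by
      intro i; fin_cases i
      · exact determinedBy_secAt e false hXS
      · exact determinedBy_secAt e false hYS
      · exact determinedBy_secAt e false hZS
    -- descent to a solved face, where `T⁺ ≥ 0` by the induction hypothesis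
    obtain ⟨G', H', hG'up, hH'up, hH'G', hG'det, hH'det, hface, hle⟩ := hD (S.erase e) G H hGup hHup hHG hGdet hHdet
    have hmixed : MixedE3Nonneg q G' H' := by
      intro W hW
      have hup : ∀ i, IsUpperSet (W i) := by
        intro i; obtain ⟨j, hj | hj⟩ := hW i <;> rw [hj]
        · exact hG'up j
        · exact hH'up j
      have hdet : ∀ i, DeterminedBy (W i) (↑(S.erase e) : Set κ) := by
        intro i; obtain ⟨j, hj | hj⟩ := hW i <;> rw [hj]
        · exact hG'det j
        · exact hH'det j
      exact IH _ _ _ (hup 0) (hup 1) (hup 2) (hdet 0) (hdet 1) (hdet 2)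
    have hT' : 0 ≤ topForm q G' H' := topForm_nonneg_of_inSolvedFace q G' H' hG'up hH'up hH'G' hmixed hface
    have hT : 0 ≤ topForm q G H := le_trans hT' hle
    -- `E_3 ≥ 0` for the two section triples (induction hypothesis)
    have E0 := IH _ _ _ (isUpperSet_secAt e false hX) (isUpperSet_secAt e false hY) (isUpperSet_secAt e false hZ)
      (determinedBy_secAt e false hXS) (determinedBy_secAt e false hYS) (determinedBy_secAt e false hZS)
    have E1 := IH _ _ _ (isUpperSet_secAt e true hX) (isUpperSet_secAt e true hY) (isUpperSet_secAt e true hZ)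
      (determinedBy_secAt e true hXS) (determinedBy_secAt e true hYS) (determinedBy_secAt e true hZS)
    rw [← sahiE_three_ind] at E0 E1
    -- `T⁺` at the sections is `b₂ + B₀ + B₃`
    have hb := SahiTwoLevel.coordPiece₂_add_eq_twoLevelPlus q e X Y Z
    simp only [ex_bernoulliWeight_ind] at hb
    have hW : 0 ≤ coordPiece₂ q e ![X, Y, Z]
        + sahiE (bernoulliWeight q) 3 ![ind (secAt e false X), ind (secAt e false Y), ind (secAt e false Z)]
        + sahiE (bernoulliWeight q) 3 ![ind (secAt e true X), ind (secAt e true Y), ind (secAt e true Z)] := by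
      rw [hb]
      simpa [topForm, hGdef, hHdef] using hT
    have h := SahiCoSunflowerTwoLevel.sahiE_three_nonneg_of_weakTwoLevelAt q e hX hY hZ hW E0 E1
    rwa [sahiE_three_ind] at h

/-- **SOLVED-FACE DESCENT ⟹ KAHN'S CONJECTURE 5.** [this work] -/
theorem kahnConjecture_of_solvedFaceDescent (h : SolvedFaceDescent) : KahnConjecture :=
  fun κ _ q _ _ _ hA hB hC => sahiE3_nonneg_of_solvedFaceDescentOn q (h κ q) hA hB hC

/-- **SOLVED-FACE DESCENT ⟹ `MasterFamilyNonneg 3`** (Sahi's `C_3` on product measures). [this work] -/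
theorem masterFamilyNonneg_three_of_solvedFaceDescent (h : SolvedFaceDescent) : MasterFamilyNonneg 3 :=
  masterFamilyNonneg_three_iff_kahnConjecture.2 (kahnConjecture_of_solvedFaceDescent h)

end SahiTwoLevelVariational

end Summit.CriticalPhenomena.PercolationContinuityZ3.Theorems
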